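import Summits.BirchSwinnertonDyer.Rank1Residual.O5.CongruenceNumberTwistThree
import HarnessLib

/-!
# O5 (`9 ∣ N`): the congruence defect JUMPS BY ONE across the `(−3)`-twin — unconditionally at `p = 3`

HONEST FRAMING (cell `b2b-bsdres`, run/shared/lean/b2b/bsd-rank1-residual/, verbatim in every
file): the goal of the cell is to DELETE the COMBINATION-SHAPED residual classes of the
Birch–Swinnerton-Dyer formula for ALL analytic-rank `≤ 1` elliptic curves over `ℚ` — assembled
STRICTLY from published theorems — so that the rank-`≤ 1` remainder becomes exactly the
CONSTRUCTION-SHAPED classes, which are TYPED, NOT attempted. This is not "finishing BSD". Lane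
CLASS-CLOSURE, team o5 (`9 ∥ N`); planner o5-r2 GEN 7 (G7-2) corollary / typer cc-typer-5 GEN 7
(`O5/CongruenceNumberTwist.lean` §2); prover seat `b2b-bsdres-x11b3-p5` (gen. 7, cross-cell pool).
THEOREMS ONLY; nothing booked; no RESIDUAL-MAP mark / label / count moved; O5 OPEN; the
`@[conjecture]` nodes `CongruenceNumberTwin` (∀ odd `p`), `CongruenceNumberTwistJumpAtNine`,
`CongruenceDefectFlatTwinAtNine`, `CongruenceDefectLawAtNine` are UNTOUCHED and NOT discharged.

## What

cc-typer-5's corollaries `congDefect_twin_eq_add_one` and `padicValNat_deg_lt_congruenceNumber_of_twin`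
(`O5/CongruenceNumberTwist.lean` §2) take the twin conjecture `hT : CongruenceNumberTwin` (all odd `p`)
as a hypothesis and use it only at the prime in hand. At `p = 3` that instance is a THEOREM
(`congruenceNumber_twin_three`, `O5/CongruenceNumberTwistThree.lean`), so the two corollaries hold
at `p = 3` WITHOUT `hT`:

* `congDefect_twin_three_eq_add_one`: `ord₃ r_W + ord₃ m_{W'} = ord₃ r_{W'} + ord₃ m_W + 1` for an
  additive twin pair `W' ≅ W ⊗ χ₋₃` at the same level `9 ∣ N`, `|u(C)| = 1`, equal `|c|`;
* `padicValNat_deg_lt_congruenceNumber_twin_three`: `ord₃ m_W < ord₃ r_W`, given moreover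
  `m_{W'} ∣ r_{W'} ≠ 0` (ARS Thm. 2.1 at the twin, supplied as a hypothesis exactly as in cc-typer-5's
  file) — o5-r2's 'type-III third of T-O5-M: `3 ∣ r_E/m_E`, multiplicity one fails at `(3, I_f)`'
  now rests on Watkins (tree theorem), the Manin-constant clause and ARS 2.1 only — no twist conjecture.

The remaining hypotheses are cc-typer-5's binders verbatim (minus `hT`, the conductor equalities and
global minimality, which the `p = 3` twin theorem does not need).

References: [Watkins2002] §2.1; [AgasheRibetStein2012] §2.1, Thm. 2.1, Prop. 5.9; cell files
`HOME/b2b-bsdres-o5-r2/gen7/{O5-GEN7.md, TWIN-PROOF.md}`.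
-/

set_option autoImplicit false

noncomputable section

open scoped Classical

open WeierstrassCurve Summit.BirchSwinnertonDyer.Rank1Residual.Additive
  Literature.NumberTheory.EllipticCurves.Rank1Residual
  Literature.NumberTheory.EllipticCurves.ModularForms
  Literature.NumberTheory.DiophantineGeometry

namespace Summit.BirchSwinnertonDyer.Rank1Residual.O5

section TwinJumpThree

variable {W W' : WeierstrassCurve ℚ} [W.IsElliptic] [W'.IsElliptic] {N : ℕ} [NeZero N]

/-- **`e₃(W) = e₃(W') + 1` across an additive `(−3)`-twin pair, UNCONDITIONALLY** (ℕ-safe form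
`ord₃ r_W + ord₃ m_{W'} = ord₃ r_{W'} + ord₃ m_W + 1`): TWIN at `3` (`congruenceNumber_twin_three`,
theorem) + Watkins' `V₃ = 3` (tree, via cc-typer-5's `padicValNat_deg_twin_eq_add_one`).
[cite: Watkins2002, §2.1 (p. 491)] [cite: AgasheRibetStein2012, §2.1] -/
theorem congDefect_twin_three_eq_add_one (C : VariableChange ℚ)
    (hW' : C • W.quadraticTwist (pStarRat 3) = W') (hu : |(C.u : ℚ)| = 1)
    (hadd : Addv W 3) (hadd' : Addv W' 3)
    (D : ModularParametrizationData W N) (D' : ModularParametrizationData W' N) (h9 : 3 ^ 2 ∣ N)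
    (hc : D.c.natAbs = D'.c.natAbs) :
    padicValNat 3 (congruenceNumber D.f) + padicValNat 3 D'.modularDegree =
      padicValNat 3 (congruenceNumber D'.f) + padicValNat 3 D.modularDegree + 1 := by
  haveI : Fact (Nat.Prime 3) := ⟨Nat.prime_three⟩
  rw [congruenceNumber_twin_three C hW' D D' h9,
    padicValNat_deg_twin_eq_add_one (by norm_num) C hW' hu hadd hadd' D D' hc]
  ring

/-- **`ord₃ m_W < ord₃ r_W` on the `3`-minimal member of an additive `(−3)`-twin pair at `9 ∣ N`,
UNCONDITIONALLY in the twin** (o5-r2 GEN 7: for an optimal type-`III` curve at `9 ∥ N`,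
`3 ∣ r_E/m_E`, so multiplicity one FAILS at `(3, I_f)` by ARS Prop. 5.9): from
`congDefect_twin_three_eq_add_one` and `m_{W'} ∣ r_{W'} ≠ 0` at the twin (ARS Thm. 2.1, supplied as the
hypotheses `h21'`, `hr'` exactly as in cc-typer-5's `padicValNat_deg_lt_congruenceNumber_of_twin`).
[cite: AgasheRibetStein2012, Thm. 2.1 and Prop. 5.9] [cite: Watkins2002, §2.1 (p. 491)] -/
theorem padicValNat_deg_lt_congruenceNumber_twin_three (C : VariableChange ℚ)
    (hW' : C • W.quadraticTwist (pStarRat 3) = W') (hu : |(C.u : ℚ)| = 1)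
    (hadd : Addv W 3) (hadd' : Addv W' 3)
    (D : ModularParametrizationData W N) (D' : ModularParametrizationData W' N) (h9 : 3 ^ 2 ∣ N)
    (hc : D.c.natAbs = D'.c.natAbs)
    (h21' : D'.modularDegree ∣ congruenceNumber D'.f) (hr' : congruenceNumber D'.f ≠ 0) :
    padicValNat 3 D.modularDegree < padicValNat 3 (congruenceNumber D.f) := by
  have hjump := congDefect_twin_three_eq_add_one C hW' hu hadd hadd' D D' h9 hc
  obtain ⟨m, hm⟩ := h21'
  have hm0 : D'.modularDegree ≠ 0 := fun h ↦ hr' (by rw [hm, h, zero_mul])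
  have hk0 : m ≠ 0 := fun h ↦ hr' (by rw [hm, h, mul_zero])
  have hle : padicValNat 3 D'.modularDegree ≤ padicValNat 3 (congruenceNumber D'.f) := by
    rw [hm, padicValNat.mul hm0 hk0]
    exact Nat.le_add_right _ _
  omega

end TwinJumpThree

end Summit.BirchSwinnertonDyer.Rank1Residual.O5
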